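import Literature.NumberTheory.Transcendental.LcmOfConsecutiveIntegersPNT
import Mathlib.Tactic
import HarnessLib

/-!
# `L^{≥l}_{n,k}`: primes `p > l` with a multiple in `[n−k, n]` (CDT Lemma 50)

Calegari–Dimitrov–Tang, arXiv:2408.15403, §5 Lemma 50 (p. 44), "a variant of" Lemma 48: for
`k, l ≤ n` let `L^{≥l}_{n,k}` be the product of the primes `p > l` that have some multiple in the
interval `[n−k, n]`. Then (2): for every `ε > 0` there is `N(ε)` such that for all `n > N` and all
`0 ≤ k, l ≤ n`,
`log L^{≥l}_{n,k} ≤ k Σ_{h=1}^{⌊(n−k)/max(k,l)⌋} 1/h + (n/⌊(n + (l−k)⁺)/max(k,l)⌋ − l)⁺ + ε n`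
("if `k = l = 0`, the right-hand side is to be interpreted as `o(n)`"). Printed proof: "As in the
proof of Lemma 48, the primes `p ≤ n` that do not have any multiples among `n−k,…,n` are the ones
that lie in `∪_{a=1}^{⌊n/k⌋−1} (n/(a+1), (n−k)/a)`. The new assumption here that `p > l`
implies that `a < (n−k)/l`", so that with `h₀ = ⌊(n−k)/max(k,l)⌋` only the gaps `a < h₀` and
the cut gap `(max(n/(h₀+1), l), (n−k)/h₀)` are removed from `(l, n]`; the prime number theorem
gives `n − l − Σ_{a≤h₀}((n−k)/a − …) = k Σ_{a≤h₀} 1/a + (n/(h₀+1) − l)⁺ + o(n)`, and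
`n/(h₀+1) = n/⌊(n+(l−k)⁺)/max(k,l)⌋`; the remaining ranges of `k, l` are reduced to Lemma 48.

This file proves (2) uniformly in `k, l` (this is the integrated-denominator input of
Definition 51 / `τ♯`) and the matching lower bound of (1): the sieve with a cut (`log_radGe_le_sieve`, valid for every `C`), the main
regime `n ≤ (Q+1) max(k,l)` by the prime number theorem (`log_radGe_le_main`, all evaluation
points are `≥ n/(Q+1) − 1`), and the small regime through `L^{≥l}_{n,k} ∣ L_{n,k}` and Lemma 48.

* `radGe n k l` — `L^{≥l}_{n,k}` (as `∏ {p ∣ lcm(n−k,…,n) prime, p > l}`); `log_radGe`,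
  `radGe_dvd_lcmIcc`, `log_radGe_le_log_lcmIcc`.
* `gapPrimesGe`, `theta_sub_theta_le_sum_gapPrimesGe`, `log_radGe_le_sieve` — the cut sieve.
* `lemma50_errorBound`, `sum_max_div_le`, `log_radGe_le_main` — the main regime.
* `cdt_index_eq` — `⌊(n+(l−k)⁺)/max(k,l)⌋ = ⌊(n−k)/max(k,l)⌋ + 1`.
* `log_radGe_le_uniform` — **Lemma 50 (2)**.
* `sieve_le_log_radGe` (the reverse cut sieve), `sum_max_div_ge`, `lemma50_lower_errorBound`,
  `le_log_radGe_main`, `mainTerm50_le_of_small`, `le_log_radGe_uniform` — **Lemma 50 (1), lower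
  half**, uniformly in `1 ≤ k < n`, `l ≤ n`; with (2) this is the uniform asymptotic of (1).

No named facts.

## References

* [CalegariDimitrovTang2024] arXiv:2408.15403, §5 Lemma 50 (p. 44), Definition 51 (p. 45).
-/

noncomputable section

open Real Finset

namespace Literature.NumberTheory.Transcendental

namespace CalegariDimitrovTang

/-! ## `L^{≥l}_{n,k}`: the product of the primes `p > l` with a multiple in `[n−k, n]` -/

/-- `L^{≥l}_{n,k} := ∏ {p prime : p > l, p ∣ lcm(n−k,…,n)}` — for `n − k ≥ 1` these are exactly
the primes `p > l` having some multiple in `[n−k, n]`.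
[cite: CalegariDimitrovTang2024, §5 Lemma 50 (p. 44)] -/
def radGe (n k l : ℕ) : ℕ := ∏ p ∈ (lcmIcc (n - k) n).primeFactors.filter (fun p => l < p), p

/-- `log L^{≥l}_{n,k} = Σ_{p | L, p > l} log p`. [folklore] -/
theorem log_radGe (n k l : ℕ) :
    Real.log (radGe n k l) = ∑ p ∈ (lcmIcc (n - k) n).primeFactors.filter (fun p => l < p),
      Real.log p := by
  unfold radGe
  push_cast
  rw [Real.log_prod]
  intro p hp
  have := Nat.prime_of_mem_primeFactors (Finset.mem_filter.mp hp).1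
  exact_mod_cast this.ne_zero

/-- `L^{≥l}_{n,k}` divides `L_{n,k}` (a product of distinct prime factors). [folklore] -/
theorem radGe_dvd_lcmIcc (n k l : ℕ) : radGe n k l ∣ lcmIcc (n - k) n := by
  unfold radGe
  exact (Finset.prod_primes_dvd _ (fun p hp => (Nat.prime_of_mem_primeFactors
    (Finset.mem_filter.mp hp).1).prime) fun p hp =>
      Nat.dvd_of_mem_primeFactors (Finset.mem_filter.mp hp).1)

/-- `log L^{≥l}_{n,k} ≤ log L_{n,k}` (for `n − k ≥ 1`). [folklore] -/
theorem log_radGe_le_log_lcmIcc {n k : ℕ} (l : ℕ) (hnk : 1 ≤ n - k) :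
    Real.log (radGe n k l) ≤ Real.log (lcmIcc (n - k) n) := by
  have h0 : lcmIcc (n - k) n ≠ 0 := lcmIcc_ne_zero hnk
  have hd := radGe_dvd_lcmIcc n k l
  have hr0 : radGe n k l ≠ 0 := fun h => h0 (Nat.eq_zero_of_zero_dvd (h ▸ hd))
  exact Real.log_le_log (by exact_mod_cast Nat.pos_of_ne_zero hr0)
    (by exact_mod_cast Nat.le_of_dvd (Nat.pos_of_ne_zero h0) hd)

/-- `0 ≤ log L^{≥l}_{n,k}`. [folklore] -/
theorem log_radGe_nonneg (n k l : ℕ) : 0 ≤ Real.log (radGe n k l) :=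
  Real.log_natCast_nonneg _

/-! ### The sieve with a lower cut at `l` -/

/-- Gap primes above the cut: `max(n/(c+1), l) < p ≤ (n−k)/c − 1`, `p ≤ n`. [folklore] -/
def gapPrimesGe (n k l c : ℕ) : Finset ℕ :=
  (Nat.primesLE n).filter fun p =>
    max ((n : ℝ) / (c + 1)) (l : ℝ) < p ∧ (p : ℝ) ≤ ((n - k : ℕ) : ℝ) / c - 1

/-- `gapPrimesGe ⊆ gapPrimes`. [folklore] -/
theorem gapPrimesGe_subset (n k l c : ℕ) : gapPrimesGe n k l c ⊆ gapPrimes n k c := by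
  intro p hp
  unfold gapPrimesGe at hp
  unfold gapPrimes
  rw [Finset.mem_filter] at hp ⊢
  exact ⟨hp.1, (le_max_left _ _).trans_lt hp.2.1, hp.2.2⟩

/-- `θ(y) − θ(max(x, l)) ≤ Σ_{gapPrimesGe} log p`. [folklore] -/
theorem theta_sub_theta_le_sum_gapPrimesGe (n k l c : ℕ) (hc : 1 ≤ c) :
    Chebyshev.theta (((n - k : ℕ) : ℝ) / c - 1) -
      Chebyshev.theta (max ((n : ℝ) / (c + 1)) (l : ℝ)) ≤
      ∑ p ∈ gapPrimesGe n k l c, Real.log p := by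
  set x : ℝ := max ((n : ℝ) / (c + 1)) (l : ℝ) with hx
  set y : ℝ := ((n - k : ℕ) : ℝ) / c - 1 with hy
  have hx0 : 0 ≤ x := le_trans (by positivity) (le_max_left _ _)
  rw [Chebyshev.theta_eq_sum_primesLE y, Chebyshev.theta_eq_sum_primesLE x]
  rw [← Finset.sum_filter_add_sum_filter_not (Nat.primesLE ⌊y⌋₊) (fun p => p ≤ ⌊x⌋₊)]
  have h1 : ∑ p ∈ (Nat.primesLE ⌊y⌋₊).filter (fun p => p ≤ ⌊x⌋₊), Real.log p ≤
      ∑ p ∈ Nat.primesLE ⌊x⌋₊, Real.log p := by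
    refine Finset.sum_le_sum_of_subset_of_nonneg ?_ fun p _ _ => Real.log_natCast_nonneg p
    intro p hp
    rw [Finset.mem_filter, Nat.mem_primesLE] at hp
    exact Nat.mem_primesLE.mpr ⟨hp.2, hp.1.2⟩
  have h2 : ∑ p ∈ (Nat.primesLE ⌊y⌋₊).filter (fun p => ¬ p ≤ ⌊x⌋₊), Real.log p ≤
      ∑ p ∈ gapPrimesGe n k l c, Real.log p := by
    refine Finset.sum_le_sum_of_subset_of_nonneg ?_ fun p _ _ => Real.log_natCast_nonneg p
    intro p hp
    rw [Finset.mem_filter, Nat.mem_primesLE] at hp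
    obtain ⟨⟨hpy, hpp⟩, hpx⟩ := hp
    push Not at hpx
    have hy0 : 0 ≤ y := by
      by_contra hneg
      push Not at hneg
      rw [Nat.floor_of_nonpos hneg.le] at hpy
      exact absurd hpy (by have := hpp.two_le; omega)
    have hpy' : (p : ℝ) ≤ y := (Nat.le_floor_iff hy0).mp hpy
    have hpx' : x < p := (Nat.floor_lt hx0).mp hpx
    unfold gapPrimesGe
    rw [Finset.mem_filter, Nat.mem_primesLE]
    refine ⟨⟨?_, hpp⟩, hpx', hpy'⟩
    have hc0 : (1 : ℝ) ≤ c := by exact_mod_cast hc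
    have hnk : ((n - k : ℕ) : ℝ) ≤ n := by exact_mod_cast Nat.sub_le n k
    have : y ≤ n := by
      rw [hy]
      have : ((n - k : ℕ) : ℝ) / c ≤ ((n - k : ℕ) : ℝ) := div_le_self (by positivity) hc0
      linarith
    exact_mod_cast hpy'.trans this
  linarith

/-- **The sieve with a cut at `l`** (the heart of Lemma 50): for `n − k ≥ 1`, `l ≤ n` and any `C`,
`log L^{≥l}_{n,k} ≤ (θ(n) − θ(l)) − Σ_{c=1}^{C} (θ((n−k)/c − 1) − θ(max(n/(c+1), l)))`.
[cite: CalegariDimitrovTang2024, §5 proof of Lemma 50: "the primes p ≤ n that do not have any multiples among n−k,…,n are the ones that lie in ∪ (n/(a+1), (n−k)/a). The new assumption here that p > l implies that a < (n−k)/l" (p. 44)] -/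
theorem log_radGe_le_sieve (n k l C : ℕ) (hnk : 1 ≤ n - k) (hln : l ≤ n) :
    Real.log (radGe n k l) ≤ (Chebyshev.theta n - Chebyshev.theta l) -
      ∑ c ∈ Finset.Icc 1 C, (Chebyshev.theta (((n - k : ℕ) : ℝ) / c - 1) -
        Chebyshev.theta (max ((n : ℝ) / (c + 1)) (l : ℝ))) := by
  set L := lcmIcc (n - k) n with hL
  have hsub : L.primeFactors ⊆ Nat.primesLE n := primeFactors_lcmIcc_subset hnk
  rw [log_radGe]
  -- `θ(n) − θ(l) = Σ_{l < p ≤ n} log p`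
  have hθ : Chebyshev.theta n - Chebyshev.theta l =
      ∑ p ∈ (Nat.primesLE n).filter (fun p => l < p), Real.log p := by
    rw [Chebyshev.theta_eq_sum_primesLE_log, Chebyshev.theta_eq_sum_primesLE_log,
      ← Finset.sum_filter_add_sum_filter_not (Nat.primesLE n) (fun p => l < p)]
    have : (Nat.primesLE n).filter (fun p => ¬ l < p) = Nat.primesLE l := by
      ext p
      simp only [Finset.mem_filter, Nat.mem_primesLE, not_lt]
      constructor
      · rintro ⟨⟨_, hpp⟩, hpl⟩; exact ⟨hpl, hpp⟩
      · rintro ⟨hpl, hpp⟩; exact ⟨⟨hpl.trans hln, hpp⟩, hpl⟩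
    rw [this]; ring
  -- split the primes `l < p ≤ n` into divisors and non-divisors of `L`
  have hsplit : ∑ p ∈ (Nat.primesLE n).filter (fun p => l < p), Real.log p =
      ∑ p ∈ (L.primeFactors).filter (fun p => l < p), Real.log p +
      ∑ p ∈ ((Nat.primesLE n) \ L.primeFactors).filter (fun p => l < p), Real.log p := by
    rw [← Finset.sum_union]
    · congr 1
      ext p
      simp only [Finset.mem_filter, Finset.mem_union, Finset.mem_sdiff]
      constructor
      · rintro ⟨hp, hl⟩
        by_cases h : p ∈ L.primeFactors
        · exact Or.inl ⟨h, hl⟩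
        · exact Or.inr ⟨⟨hp, h⟩, hl⟩
      · rintro (⟨h, hl⟩ | ⟨⟨hp, _⟩, hl⟩)
        · exact ⟨hsub h, hl⟩
        · exact ⟨hp, hl⟩
    · rw [Finset.disjoint_left]
      rintro p hp hp'
      exact (Finset.mem_sdiff.mp (Finset.mem_filter.mp hp').1).2 (Finset.mem_filter.mp hp).1
  -- the cut gap primes are non-divisors `> l`, pairwise disjoint
  have hdisj : ((Finset.Icc 1 C : Finset ℕ) : Set ℕ).PairwiseDisjoint (gapPrimesGe n k l) := by
    intro c hc c' hc' hne
    have hc1 : 1 ≤ c := (Finset.mem_Icc.mp hc).1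
    have hc'1 : 1 ≤ c' := (Finset.mem_Icc.mp hc').1
    rcases Nat.lt_or_gt_of_ne hne with h | h
    · exact (disjoint_gapPrimes hc1 h).mono (gapPrimesGe_subset _ _ _ _) (gapPrimesGe_subset _ _ _ _)
    · exact ((disjoint_gapPrimes hc'1 h).mono (gapPrimesGe_subset _ _ _ _)
        (gapPrimesGe_subset _ _ _ _)).symm
  have hU : (Finset.Icc 1 C).biUnion (gapPrimesGe n k l) ⊆
      ((Nat.primesLE n) \ L.primeFactors).filter (fun p => l < p) := by
    intro p hp
    rw [Finset.mem_biUnion] at hp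
    obtain ⟨c, hc, hpc⟩ := hp
    have hc1 : 1 ≤ c := (Finset.mem_Icc.mp hc).1
    have hpg := gapPrimesGe_subset _ _ _ _ hpc
    rw [Finset.mem_filter, Finset.mem_sdiff]
    refine ⟨⟨(Finset.mem_filter.mp hpc).1, fun hpL => ?_⟩, ?_⟩
    · exact not_dvd_of_mem_gapPrimes hc1 hnk hpg (Nat.dvd_of_mem_primeFactors hpL)
    · have := (Finset.mem_filter.mp hpc).2.1
      exact_mod_cast (le_max_right _ _).trans_lt this
  have h1 : ∑ c ∈ Finset.Icc 1 C, (Chebyshev.theta (((n - k : ℕ) : ℝ) / c - 1) -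
      Chebyshev.theta (max ((n : ℝ) / (c + 1)) (l : ℝ))) ≤
      ∑ c ∈ Finset.Icc 1 C, ∑ p ∈ gapPrimesGe n k l c, Real.log p :=
    Finset.sum_le_sum fun c hc => theta_sub_theta_le_sum_gapPrimesGe n k l c (Finset.mem_Icc.mp hc).1
  have h2 : ∑ c ∈ Finset.Icc 1 C, ∑ p ∈ gapPrimesGe n k l c, Real.log p =
      ∑ p ∈ (Finset.Icc 1 C).biUnion (gapPrimesGe n k l), Real.log p :=
    (Finset.sum_biUnion hdisj).symm
  have h3 : ∑ p ∈ (Finset.Icc 1 C).biUnion (gapPrimesGe n k l), Real.log p ≤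
      ∑ p ∈ ((Nat.primesLE n) \ L.primeFactors).filter (fun p => l < p), Real.log p :=
    Finset.sum_le_sum_of_subset_of_nonneg hU fun p _ _ => Real.log_natCast_nonneg p
  rw [hθ, hsplit]
  linarith

/-! ### Lemma 50 (2): the main regime `max(k,l) ≥ n/(Q+1)` -/

/-- The bookkeeping inequality behind the error term of Lemma 50. [folklore] -/
theorem lemma50_errorBound {η n k l h H Q X mx : ℝ} (hη0 : 0 < η) (hn0 : 0 < n)
    (hk0 : 0 ≤ k) (hh0 : 0 ≤ h) (hhQ : h ≤ Q) (hH0 : 0 ≤ H) (hHQ : H ≤ Q)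
    (hmxn : mx ≤ n) :
    (1 + η) * n + (-l + η * n + X) - (1 - η) * ((n - k) * H - h) +
        (1 + η) * (n * (H - 1) + mx) ≤
      H * k + (mx - l) + (Q + X + η * (n * (2 + 2 * Q))) := by
  have hid : (1 + η) * n + (-l + η * n + X) - (1 - η) * ((n - k) * H - h) +
      (1 + η) * (n * (H - 1) + mx) =
      H * k + (mx - l) + (h + X + η * (n + n + ((n - k) * H - h) + (n * (H - 1) + mx))) := by
    ring
  rw [hid]
  have e1 : (n - k) * H - h ≤ n * Q := by nlinarith
  have e2 : n * (H - 1) + mx ≤ n * Q := by nlinarith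
  have e3 : η * (n + n + ((n - k) * H - h) + (n * (H - 1) + mx)) ≤ η * (n * (2 + 2 * Q)) := by
    refine mul_le_mul_of_nonneg_left ?_ hη0.le
    nlinarith
  linarith

/-- `Σ_{c=1}^{h} max(n/(c+1), l) ≤ n (H_{h+1} − 1) + (max(n/(h+1), l) − n/(h+1))` when
`l (c+1) ≤ n` for all `c < h` (all but the last cut are inactive). [folklore] -/
theorem sum_max_div_le (n l h : ℕ) (hl : ∀ c, c + 1 ≤ h → (l : ℝ) * (c + 1) ≤ n) :
    ∑ c ∈ Finset.Icc 1 h, max ((n : ℝ) / (c + 1)) (l : ℝ) ≤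
      n * ((harmonic (h + 1) : ℝ) - 1) + (max ((n : ℝ) / (h + 1)) (l : ℝ) - n / (h + 1)) := by
  induction h with
  | zero =>
      rw [Finset.Icc_eq_empty (by omega), Finset.sum_empty]
      have h1 : (harmonic (0 + 1) : ℝ) = 1 := by
        rw [zero_add, harmonic_succ, harmonic_zero]; simp
      rw [h1, sub_self, mul_zero, zero_add, sub_nonneg]
      exact le_max_left _ _
  | succ h ih =>
      -- peel off the last term `c = h + 1`
      rw [Finset.sum_Icc_succ_top (by omega)]
      have ih' := ih (fun c hc => hl c (by omega))
      -- for the previous block the last cut is inactive: `max(n/(h+1), l) = n/(h+1)`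
      have hprev : max ((n : ℝ) / (h + 1)) (l : ℝ) = n / (h + 1) := by
        rcases Nat.eq_zero_or_pos h with rfl | hpos
        · -- `h = 0`: the previous sum is empty; still need `l ≤ n`
          have := hl 0 (by omega)
          simp only [CharP.cast_eq_zero, zero_add, mul_one] at this
          rw [max_eq_left]; simpa using this
        · have := hl h (by omega)
          rw [max_eq_left]
          rw [le_div_iff₀ (by positivity)]; linarith
      rw [hprev] at ih'
      have hH : (harmonic (h + 1 + 1) : ℝ) = harmonic (h + 1) + 1 / ((h : ℝ) + 1 + 1) := by
        rw [harmonic_succ]; push_cast; ring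
      rw [hH]
      push_cast
      have : (n : ℝ) / (↑h + 1 + 1) = n * (1 / ((h : ℝ) + 1 + 1)) := by ring
      nlinarith [ih', this]

set_option maxHeartbeats 400000 in
/-- **CDT Lemma 50 (2), main regime** (`1 ≤ k < n`, `l ≤ n`, `n ≤ (Q+1)·max(k,l)`): for every
`Q ≥ 1`, `ε > 0` and large `n`,
`log L^{≥l}_{n,k} ≤ k·H_{h₀} + (n/(h₀+1) − l)⁺ + ε n`, `h₀ = ⌊(n−k)/max(k,l)⌋`.
[cite: CalegariDimitrovTang2024, §5 Lemma 50 (1)–(2) (p. 44)] -/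
theorem log_radGe_le_main (Q : ℕ) (hQ : 1 ≤ Q) {ε : ℝ} (hε : 0 < ε) :
    ∃ N₀ : ℕ, ∀ n k l : ℕ, N₀ ≤ n → 1 ≤ k → k < n → l ≤ n → n ≤ (Q + 1) * max k l →
      Real.log (radGe n k l) ≤
        (harmonic ((n - k) / max k l) : ℝ) * k +
          max ((n : ℝ) / (((n - k) / max k l : ℕ) + 1) - l) 0 + ε * n := by
  obtain ⟨η, hη⟩ : ∃ η : ℝ, η = ε / (4 * (Q + 1)) := ⟨_, rfl⟩
  have hQ0 : (0 : ℝ) < Q := by exact_mod_cast hQ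
  have hQ1 : (0 : ℝ) < Q + 1 := by positivity
  have hη0 : 0 < η := by rw [hη]; positivity
  obtain ⟨X₁, hX₁⟩ := Filter.eventually_atTop.mp (eventually_mul_le_theta hη0)
  obtain ⟨X₂, hX₂⟩ := Filter.eventually_atTop.mp (eventually_theta_le_mul hη0)
  set X : ℝ := max (max X₁ X₂) 0 with hXdef
  have hX0 : 0 ≤ X := le_max_right _ _
  have hXX₁ : X₁ ≤ X := (le_max_left _ _).trans (le_max_left _ _)
  have hXX₂ : X₂ ≤ X := (le_max_right _ _).trans (le_max_left _ _)
  refine ⟨max ⌈((Q : ℝ) + 1) * (X + 1)⌉₊ ⌈2 * (Q + X) / ε⌉₊, ?_⟩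
  intro n k l hn hk hkn hln hreg
  -- basic quantities
  obtain ⟨M, hM⟩ : ∃ M : ℕ, M = max k l := ⟨_, rfl⟩
  obtain ⟨h₀, hh₀⟩ : ∃ h₀ : ℕ, h₀ = (n - k) / max k l := ⟨_, rfl⟩
  rw [← hh₀]
  rw [← hM] at hreg hh₀
  have hM1 : 1 ≤ M := by rw [hM]; exact le_max_of_le_left hk
  have hM0 : (0 : ℝ) < M := by exact_mod_cast hM1
  have hn0 : (0 : ℝ) < n := by exact_mod_cast (show 0 < n by omega)
  have hnk1 : 1 ≤ n - k := by omega
  have hnkR : ((n - k : ℕ) : ℝ) = n - k := by push_cast [Nat.cast_sub hkn.le]; ring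
  have hn1 : ⌈((Q : ℝ) + 1) * (X + 1)⌉₊ ≤ n := le_of_max_le_left hn
  have hn2 : ⌈2 * (Q + X) / ε⌉₊ ≤ n := le_of_max_le_right hn
  have hnR1 : ((Q : ℝ) + 1) * (X + 1) ≤ n := (Nat.le_ceil _).trans (by exact_mod_cast hn1)
  have hnR2 : 2 * (Q + X) / ε ≤ n := (Nat.le_ceil _).trans (by exact_mod_cast hn2)
  have hregR : (n : ℝ) ≤ (Q + 1) * M := by exact_mod_cast hreg
  -- `h₀ M ≤ n − k`, `h₀ ≤ Q`
  have hh₀M : h₀ * M ≤ n - k := by rw [hh₀]; exact Nat.div_mul_le_self _ _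
  have hh₀MR : (h₀ : ℝ) * M ≤ n - k := by rw [← hnkR]; exact_mod_cast hh₀M
  have hh₀Q : h₀ ≤ Q := by
    -- `h₀ ≤ (n−k)/M < n/M ≤ Q + 1`
    have h1 : h₀ * M < (Q + 1) * M := by
      calc h₀ * M ≤ n - k := hh₀M
        _ < n := by omega
        _ ≤ (Q + 1) * M := hreg
    have := Nat.lt_of_mul_lt_mul_right h1
    omega
  have hh₀QR : (h₀ : ℝ) ≤ Q := by exact_mod_cast hh₀Q
  -- the evaluation points are `≥ n/(Q+1) − 1 ≥ X`
  have hbigX : X ≤ (n : ℝ) / (Q + 1) - 1 := by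
    rw [le_sub_iff_add_le, le_div_iff₀ hQ1]; linarith
  have hMn : (n : ℝ) / (Q + 1) ≤ M := by rw [div_le_iff₀ hQ1]; linarith
  have hX1 : ∀ t, X ≤ t → (1 - η) * t ≤ Chebyshev.theta t := fun t ht => hX₁ t (hXX₁.trans ht)
  have hX2 : ∀ t, X ≤ t → Chebyshev.theta t ≤ (1 + η) * t := fun t ht => hX₂ t (hXX₂.trans ht)
  -- the sieve with cut at `l`, `C = h₀`
  have hsieve := log_radGe_le_sieve n k l h₀ hnk1 hln
  -- `θ(n) ≤ (1+η) n`
  have hA : Chebyshev.theta n ≤ (1 + η) * n :=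
    hX2 n (hbigX.trans (by linarith [div_le_self hn0.le (show (1:ℝ) ≤ Q + 1 by linarith)]))
  -- `−θ(l) ≤ −l + η n + X`
  have hB : -Chebyshev.theta l ≤ -(l : ℝ) + η * n + X := by
    have hl0 : (0 : ℝ) ≤ l := by positivity
    have hln' : (l : ℝ) ≤ n := by exact_mod_cast hln
    by_cases hlX : X ≤ l
    · have := hX1 l hlX
      nlinarith
    · push Not at hlX
      have := Chebyshev.theta_nonneg (l : ℝ)
      nlinarith
  -- the gap terms
  have hgap : ∀ c ∈ Finset.Icc 1 h₀,
      ((1 - η) * (((n - k : ℕ) : ℝ) / c - 1) - (1 + η) * max ((n : ℝ) / (c + 1)) (l : ℝ)) ≤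
      Chebyshev.theta (((n - k : ℕ) : ℝ) / c - 1) -
        Chebyshev.theta (max ((n : ℝ) / (c + 1)) (l : ℝ)) := by
    intro c hc
    obtain ⟨hc1, hch⟩ := Finset.mem_Icc.mp hc
    have hc0 : (0 : ℝ) < c := by exact_mod_cast hc1
    have hch' : (c : ℝ) ≤ h₀ := by exact_mod_cast hch
    have hh₀0 : (0 : ℝ) < h₀ := by exact_mod_cast (show 0 < h₀ by omega)
    -- `y_c ≥ (n−k)/h₀ − 1 ≥ M − 1 ≥ n/(Q+1) − 1`
    have hy : (n : ℝ) / (Q + 1) - 1 ≤ ((n - k : ℕ) : ℝ) / c - 1 := by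
      rw [hnkR]
      have h1 : (M : ℝ) ≤ (n - k) / h₀ := by rw [le_div_iff₀ hh₀0]; linarith
      have h2 : ((n : ℝ) - k) / h₀ ≤ (n - k) / c :=
        div_le_div_of_nonneg_left (by linarith [show (k:ℝ) ≤ n from by exact_mod_cast hkn.le]) hc0 hch'
      linarith
    have hx : (n : ℝ) / (Q + 1) - 1 ≤ max ((n : ℝ) / (c + 1)) (l : ℝ) := by
      have hc1' : (0 : ℝ) < c + 1 := by positivity
      have h1 : (n : ℝ) / (Q + 1) ≤ (n : ℝ) / (c + 1) :=
        div_le_div_of_nonneg_left hn0.le hc1' (by linarith)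
      linarith [le_max_left ((n : ℝ) / (c + 1)) (l : ℝ)]
    have := hX1 _ (hbigX.trans hy)
    have := hX2 _ (hbigX.trans hx)
    linarith
  have hsum := Finset.sum_le_sum hgap
  -- evaluate the comparison sum
  obtain ⟨H, hHdef⟩ : ∃ H : ℝ, H = (harmonic h₀ : ℝ) := ⟨_, rfl⟩
  have hS1 : ∑ c ∈ Finset.Icc 1 h₀, (1 / (c : ℝ)) = H := by rw [hHdef]; exact sum_Icc_inv_eq_harmonic h₀
  have hsumY : ∑ c ∈ Finset.Icc 1 h₀, (((n - k : ℕ) : ℝ) / c - 1) = (n - k) * H - h₀ := by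
    rw [Finset.sum_sub_distrib, Finset.sum_const, Nat.card_Icc, nsmul_eq_mul, mul_one]
    have : ∑ c ∈ Finset.Icc 1 h₀, ((n - k : ℕ) : ℝ) / c = (n - k) * H := by
      rw [← hS1, Finset.mul_sum]
      exact Finset.sum_congr rfl fun c _ => by rw [hnkR]; ring
    rw [this]; push_cast; ring
  have hlc : ∀ c, c + 1 ≤ h₀ → (l : ℝ) * (c + 1) ≤ n := by
    intro c hc
    have hlM : (l : ℝ) ≤ M := by rw [hM]; exact_mod_cast le_max_right k l
    have hc' : ((c : ℝ) + 1) ≤ h₀ := by exact_mod_cast hc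
    have hkn' : (k : ℝ) ≤ n := by exact_mod_cast hkn.le
    have hk0 : (0 : ℝ) ≤ k := by positivity
    calc (l : ℝ) * (c + 1) ≤ M * h₀ := by
          apply mul_le_mul hlM hc' (by positivity) hM0.le
      _ ≤ n - k := by linarith [hh₀MR]
      _ ≤ n := by linarith
  have hsumX := sum_max_div_le n l h₀ hlc
  -- `H_{h₀+1} − 1 = H_{h₀} + 1/(h₀+1) − 1`
  have hHsucc : (harmonic (h₀ + 1) : ℝ) = H + 1 / ((h₀ : ℝ) + 1) := by
    rw [hHdef, harmonic_succ]; push_cast; ring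
  rw [hHsucc] at hsumX
  -- bounds on `H`, `mx`
  have hH0 : 0 ≤ H := by rw [← hS1]; exact Finset.sum_nonneg fun c _ => by positivity
  have hHQ : H ≤ Q := by
    rw [← hS1]
    calc ∑ c ∈ Finset.Icc 1 h₀, (1 / (c : ℝ)) ≤ ∑ c ∈ Finset.Icc 1 h₀, (1 : ℝ) := by
          refine Finset.sum_le_sum fun c hc => ?_
          have : (1 : ℝ) ≤ c := by exact_mod_cast (Finset.mem_Icc.mp hc).1
          exact (div_le_one (by linarith)).mpr this
      _ = h₀ := by simp
      _ ≤ Q := hh₀QR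
  set mx : ℝ := max ((n : ℝ) / (h₀ + 1)) (l : ℝ) with hmx
  have hmx0 : 0 ≤ mx := le_trans (by positivity) (le_max_left _ _)
  have hmxn : mx ≤ n := max_le (div_le_self hn0.le (by linarith [show (0:ℝ) ≤ h₀ by positivity]))
    (by exact_mod_cast hln)
  have hk0 : (0 : ℝ) ≤ k := by positivity
  have hkn' : (k : ℝ) ≤ n := by exact_mod_cast hkn.le
  have hh₀0' : (0 : ℝ) ≤ h₀ := by positivity
  have herr := lemma50_errorBound (l := (l : ℝ)) (X := X) hη0 hn0 hk0 hh₀0' hh₀QR hH0 hHQ hmxn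
  -- `Q + X + η n (2 + 2Q) ≤ ε n`
  have hε1 : η * (n * (2 + 2 * Q)) = ε / 2 * n := by rw [hη]; field_simp; ring
  have hε2 : (Q : ℝ) + X ≤ ε / 2 * n := by
    have := hnR2; rw [div_le_iff₀ hε] at this; linarith
  -- `(mx − l) = (n/(h₀+1) − l)⁺`
  have hpos : mx - l = max ((n : ℝ) / (h₀ + 1) - l) 0 := by
    rw [hmx]
    rcases le_total ((n : ℝ) / (h₀ + 1)) l with hle | hle
    · rw [max_eq_right hle, max_eq_right (by linarith)]; ring
    · rw [max_eq_left hle, max_eq_left (by linarith)]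
  -- combine
  have hmain : (1 + η) * n + (-(l : ℝ) + η * n + X) -
      ∑ c ∈ Finset.Icc 1 h₀, ((1 - η) * (((n - k : ℕ) : ℝ) / c - 1) -
        (1 + η) * max ((n : ℝ) / (c + 1)) (l : ℝ)) ≤
      (1 + η) * n + (-(l : ℝ) + η * n + X) - (1 - η) * ((n - k) * H - h₀) +
        (1 + η) * (n * (H + 1 / ((h₀ : ℝ) + 1) - 1) + (mx - n / (h₀ + 1))) := by
    rw [Finset.sum_sub_distrib, ← Finset.mul_sum, ← Finset.mul_sum, hsumY]
    have h1η : 0 ≤ 1 + η := by linarith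
    have := mul_le_mul_of_nonneg_left hsumX h1η
    linarith
  have hrew : n * (H + 1 / ((h₀ : ℝ) + 1) - 1) + (mx - n / (h₀ + 1)) = n * (H - 1) + mx := by ring
  rw [hrew] at hmain
  have hcast : ((((n - k) / M : ℕ) : ℕ) : ℝ) + 1 = (h₀ : ℝ) + 1 := by rw [hh₀]
  calc Real.log (radGe n k l)
      ≤ (Chebyshev.theta n - Chebyshev.theta l) -
          ∑ c ∈ Finset.Icc 1 h₀, (Chebyshev.theta (((n - k : ℕ) : ℝ) / c - 1) -
            Chebyshev.theta (max ((n : ℝ) / (c + 1)) (l : ℝ))) := hsieve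
    _ ≤ (1 + η) * n + (-(l : ℝ) + η * n + X) -
          ∑ c ∈ Finset.Icc 1 h₀, ((1 - η) * (((n - k : ℕ) : ℝ) / c - 1) -
            (1 + η) * max ((n : ℝ) / (c + 1)) (l : ℝ)) := by linarith
    _ ≤ H * k + (mx - l) + (Q + X + η * (n * (2 + 2 * Q))) := hmain.trans herr
    _ ≤ H * k + max ((n : ℝ) / (h₀ + 1) - l) 0 + ε * n := by rw [hpos]; linarith
    _ = (harmonic h₀ : ℝ) * k + max ((n : ℝ) / ((h₀ : ℕ) + 1) - l) 0 + ε * n := by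
          rw [hHdef]


/-! ### Lemma 50 (2): all `0 ≤ k, l ≤ n` -/

/-- CDT's index: `⌊(n + (l−k)⁺)/max(k,l)⌋ = ⌊(n−k)/max(k,l)⌋ + 1` (for `max(k,l) ≥ 1`, `k ≤ n`; in
`ℕ`, `l - k = (l−k)⁺`). [cite: CalegariDimitrovTang2024, §5 proof of Lemma 50: "n/(h₀+1) = n/(⌊(n−k)/max(k,l)⌋+1) = n/⌊(n + (l−k)⁺)/max(k,l)⌋" (p. 44)] -/
theorem cdt_index_eq (n k l : ℕ) (hM : 1 ≤ max k l) (hkn : k ≤ n) :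
    (n + (l - k)) / max k l = (n - k) / max k l + 1 := by
  have key : n + (l - k) = (n - k) + max k l := by
    rcases le_total k l with h | h
    · rw [max_eq_right h]; omega
    · rw [max_eq_left h, Nat.sub_eq_zero_of_le h]; omega
  rw [key, Nat.add_div_right _ (by omega)]

/-- `L^{≥l}_{n,0} ∣ n`, so `log L^{≥l}_{n,0} ≤ log n`. [folklore] -/
theorem log_radGe_zero_le (n l : ℕ) (hn : 1 ≤ n) : Real.log (radGe n 0 l) ≤ Real.log n := by
  have h := log_radGe_le_log_lcmIcc (n := n) (k := 0) l (by simpa using hn)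
  simpa [lcmIcc_self] using h

/-- `L^{≥l}_{n,n} = 1` (degenerate range containing `0`). [folklore] -/
theorem radGe_self (n l : ℕ) : radGe n n l = 1 := by
  unfold radGe
  rw [Nat.sub_self, lcmIcc_zero]
  simp

set_option maxHeartbeats 400000 in
/-- **CDT Lemma 50 (2)**: for every `ε > 0` there is `N₀` such that for all `n ≥ N₀` and all
`0 ≤ k, l ≤ n`,
`log L^{≥l}_{n,k} ≤ k Σ_{h=1}^{⌊(n−k)/max(k,l)⌋} 1/h + (n/⌊(n+(l−k)⁺)/max(k,l)⌋ − l)⁺ + ε n`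
(here with `⌊(n+(l−k)⁺)/max(k,l)⌋ = ⌊(n−k)/max(k,l)⌋ + 1`, `cdt_index_eq`; for `k = l = 0` the
main terms vanish). Small `max(k,l) < n/(Q+1)` is handled through `L^{≥l}_{n,k} ∣ L_{n,k}` and
Lemma 48 (`log_lcmIcc_le_uniform`, `mainTerm_le_of_lt`), the main regime by `log_radGe_le_main`.
[cite: CalegariDimitrovTang2024, §5 Lemma 50 (2) (p. 44)] -/
theorem log_radGe_le_uniform {ε : ℝ} (hε : 0 < ε) :
    ∃ N₀ : ℕ, ∀ n k l : ℕ, N₀ ≤ n → k ≤ n → l ≤ n →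
      Real.log (radGe n k l) ≤
        (harmonic ((n - k) / max k l) : ℝ) * k +
          max ((n : ℝ) / (((n - k) / max k l : ℕ) + 1) - l) 0 + ε * n := by
  -- `Q` with `4/√(Q+1) ≤ ε/2`
  set Q : ℕ := ⌈64 / ε ^ 2⌉₊ + 1 with hQdef
  have hQ1 : 1 ≤ Q := by omega
  have hQR : 64 / ε ^ 2 ≤ (Q : ℝ) := (Nat.le_ceil _).trans (by rw [hQdef]; push_cast; linarith)
  obtain ⟨N₁, hN₁⟩ := log_radGe_le_main Q hQ1 hε
  obtain ⟨N₂, hN₂⟩ := log_lcmIcc_le_uniform (half_pos hε)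
  -- `log n ≤ ε n` eventually
  obtain ⟨X₃, hX₃⟩ := Filter.eventually_atTop.mp
    ((Real.isLittleO_log_id_atTop.bound hε).and (Filter.eventually_ge_atTop (1 : ℝ)))
  refine ⟨max (max N₁ N₂) (max ⌈X₃⌉₊ 1), ?_⟩
  intro n k l hn hkn hln
  have hn1 : N₁ ≤ n := le_trans (le_max_left _ _) (le_of_max_le_left hn)
  have hn2 : N₂ ≤ n := le_trans (le_max_right _ _) (le_of_max_le_left hn)
  have hn3 : ⌈X₃⌉₊ ≤ n := le_trans (le_max_left _ _) (le_of_max_le_right hn)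
  have hn4 : 1 ≤ n := le_trans (le_max_right _ _) (le_of_max_le_right hn)
  have hn0 : (0 : ℝ) < n := by exact_mod_cast hn4
  have hnX₃ : X₃ ≤ n := (Nat.le_ceil _).trans (by exact_mod_cast hn3)
  -- the right-hand side is `≥ ε n ≥ log n`
  have hH0 : 0 ≤ (harmonic ((n - k) / max k l) : ℝ) := by
    rw [← sum_Icc_inv_eq_harmonic]; exact Finset.sum_nonneg fun c _ => by positivity
  have hRHS : ε * n ≤ (harmonic ((n - k) / max k l) : ℝ) * k +
      max ((n : ℝ) / (((n - k) / max k l : ℕ) + 1) - l) 0 + ε * n := by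
    have : 0 ≤ (harmonic ((n - k) / max k l) : ℝ) * k := by positivity
    linarith [le_max_right ((n : ℝ) / (((n - k) / max k l : ℕ) + 1) - l) 0]
  have hlogn : Real.log n ≤ ε * n := by
    have := (hX₃ n hnX₃).1
    rw [Real.norm_of_nonneg (Real.log_nonneg (hX₃ n hnX₃).2), id, Real.norm_of_nonneg hn0.le] at this
    exact this
  -- degenerate cases
  rcases Nat.eq_zero_or_pos k with rfl | hk
  · exact ((log_radGe_zero_le n l hn4).trans hlogn).trans hRHS
  rcases eq_or_lt_of_le hkn with rfl | hkn'
  · rw [radGe_self, Nat.cast_one, Real.log_one]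
    have := mul_pos hε hn0
    linarith
  -- main dichotomy on `max k l`
  by_cases hreg : n ≤ (Q + 1) * max k l
  · exact hN₁ n k l hn1 hk hkn' hln hreg
  · push Not at hreg
    -- small `max(k,l)`: `log L^{≥l} ≤ log L_{n,k} ≤ main₄₈(k) + ε n/2 ≤ 4n/√(Q+1) + ε n/2 ≤ ε n`
    have hnk1 : 1 ≤ n - k := by omega
    have h1 := log_radGe_le_log_lcmIcc (n := n) (k := k) l hnk1
    have h2 := hN₂ n k hn2 hkn
    have hQk : Q < n / k := by
      have : (Q + 1) * k ≤ n := le_trans (Nat.mul_le_mul_left _ (le_max_left k l)) hreg.le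
      have := (Nat.le_div_iff_mul_le hk).mpr this
      omega
    have h3 := mainTerm_le_of_lt hk hkn hQk
    -- `4 n/√(Q+1) ≤ ε n / 2`
    have hQ1R : (0 : ℝ) < (Q : ℝ) + 1 := by positivity
    have hsQ : 0 < Real.sqrt (Q + 1) := Real.sqrt_pos.mpr hQ1R
    have h16 : 64 / ε ^ 2 ≤ (Q : ℝ) + 1 := by linarith
    have hsq : 8 / ε ≤ Real.sqrt (Q + 1) := by
      have h1 : Real.sqrt (64 / ε ^ 2) = 8 / ε := by
        rw [show (64 : ℝ) / ε ^ 2 = (8 / ε) ^ 2 by ring, Real.sqrt_sq (by positivity)]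
      rw [← h1]; exact Real.sqrt_le_sqrt h16
    have hbd : 4 * (n : ℝ) / Real.sqrt (Q + 1) ≤ ε / 2 * n := by
      rw [div_le_iff₀ hsQ]
      have h2 : 8 ≤ ε * Real.sqrt (Q + 1) := by
        have := mul_le_mul_of_nonneg_left hsq hε.le
        rwa [mul_div_cancel₀ _ hε.ne'] at this
      nlinarith
    linarith


/-! ### Lemma 50 (1): the matching lower bound -/

/-- **The reverse cut sieve**: for `1 ≤ k`, `1 ≤ n − k`, `l ≤ n` and `h₀ = ⌊(n−k)/max(k,l)⌋`,
`θ(n) − θ(l) − Σ_{c=1}^{h₀} (θ((n−k)/c) − θ(max(n/(c+1), l))) ≤ log L^{≥l}_{n,k}`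
(every prime `l < p ≤ n` not dividing `L_{n,k}` lies in a gap `(max(n/(c+1), l), (n−k)/c)` with
`c ≤ h₀`). [cite: CalegariDimitrovTang2024, §5 proof of Lemma 50 (p. 44)] -/
theorem sieve_le_log_radGe (n k l : ℕ) (hk : 1 ≤ k) (hnk : 1 ≤ n - k) (hln : l ≤ n) :
    (Chebyshev.theta n - Chebyshev.theta l) -
      ∑ c ∈ Finset.Icc 1 ((n - k) / max k l), (Chebyshev.theta (((n - k : ℕ) : ℝ) / c) -
        Chebyshev.theta (max ((n : ℝ) / (c + 1)) (l : ℝ))) ≤ Real.log (radGe n k l) := by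
  set L := lcmIcc (n - k) n with hL
  set M := max k l with hMdef
  set h₀ := (n - k) / M with hh₀
  have hM1 : 1 ≤ M := le_max_of_le_left hk
  have hsub : L.primeFactors ⊆ Nat.primesLE n := primeFactors_lcmIcc_subset hnk
  rw [log_radGe]
  -- `θ(n) − θ(l) = Σ_{l<p≤n} log p = Σ_{p|L, p>l} + Σ_{p∤L, l<p≤n}`
  have hθ : Chebyshev.theta n - Chebyshev.theta l =
      ∑ p ∈ (Nat.primesLE n).filter (fun p => l < p), Real.log p := by
    rw [Chebyshev.theta_eq_sum_primesLE_log, Chebyshev.theta_eq_sum_primesLE_log,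
      ← Finset.sum_filter_add_sum_filter_not (Nat.primesLE n) (fun p => l < p)]
    have : (Nat.primesLE n).filter (fun p => ¬ l < p) = Nat.primesLE l := by
      ext p
      simp only [Finset.mem_filter, Nat.mem_primesLE, not_lt]
      constructor
      · rintro ⟨⟨_, hpp⟩, hpl⟩; exact ⟨hpl, hpp⟩
      · rintro ⟨hpl, hpp⟩; exact ⟨⟨hpl.trans hln, hpp⟩, hpl⟩
    rw [this]; ring
  have hsplit : ∑ p ∈ (Nat.primesLE n).filter (fun p => l < p), Real.log p =
      ∑ p ∈ (L.primeFactors).filter (fun p => l < p), Real.log p +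
      ∑ p ∈ ((Nat.primesLE n) \ L.primeFactors).filter (fun p => l < p), Real.log p := by
    rw [← Finset.sum_union]
    · congr 1
      ext p
      simp only [Finset.mem_filter, Finset.mem_union, Finset.mem_sdiff]
      constructor
      · rintro ⟨hp, hl⟩
        by_cases h : p ∈ L.primeFactors
        · exact Or.inl ⟨h, hl⟩
        · exact Or.inr ⟨⟨hp, h⟩, hl⟩
      · rintro (⟨h, hl⟩ | ⟨⟨hp, _⟩, hl⟩)
        · exact ⟨hsub h, hl⟩
        · exact ⟨hp, hl⟩
    · rw [Finset.disjoint_left]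
      rintro p hp hp'
      exact (Finset.mem_sdiff.mp (Finset.mem_filter.mp hp').1).2 (Finset.mem_filter.mp hp).1
  -- the non-divisors `> l` are covered by the cut gaps `c = 1..h₀`
  set G : ℕ → Finset ℕ := fun c =>
    (Nat.primesLE n).filter fun p => max ((n : ℝ) / (c + 1)) (l : ℝ) < p ∧ (p : ℝ) ≤ ((n - k : ℕ) : ℝ) / c
  have hcover : ((Nat.primesLE n) \ L.primeFactors).filter (fun p => l < p) ⊆
      (Finset.Icc 1 h₀).biUnion G := by
    intro p hp
    rw [Finset.mem_filter, Finset.mem_sdiff, Nat.mem_primesLE] at hp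
    obtain ⟨⟨⟨hpn, hpp⟩, hpL⟩, hlp⟩ := hp
    have hL0 : L ≠ 0 := lcmIcc_ne_zero hnk
    have hndvd : ¬ p ∣ L := fun h => hpL (Nat.mem_primeFactors.mpr ⟨hpp, h, hL0⟩)
    obtain ⟨c, hc1, hcq, h1, h2⟩ := exists_gap_of_not_dvd hpp hk hnk hpn hndvd
    -- `c ≤ h₀`: `c p < n − k` with `p > l` gives `c l < n − k`; and `c ≤ n/k − 1` gives `c k ≤ n − k`
    have hcM : c * M ≤ n - k := by
      rcases le_total k l with hkl | hkl
      · rw [hMdef, max_eq_right hkl]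
        have : c * l < n - k := lt_of_le_of_lt (Nat.mul_le_mul_left c hlp.le) h1
        exact this.le
      · rw [hMdef, max_eq_left hkl]
        have h3 : c + 1 ≤ n / k := by omega
        have h4 : (c + 1) * k ≤ n := by
          have := (Nat.le_div_iff_mul_le hk).mp h3; linarith [mul_comm k (c+1)]
        have : c * k + k ≤ n := by nlinarith
        omega
    have hch₀ : c ≤ h₀ := by
      rw [hh₀]; exact (Nat.le_div_iff_mul_le (by omega)).mpr hcM
    rw [Finset.mem_biUnion]
    refine ⟨c, Finset.mem_Icc.mpr ⟨hc1, hch₀⟩, ?_⟩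
    simp only [G, Finset.mem_filter, Nat.mem_primesLE]
    have hc0 : (0 : ℝ) < c := by exact_mod_cast hc1
    refine ⟨⟨hpn, hpp⟩, ?_, ?_⟩
    · refine max_lt ?_ (by exact_mod_cast hlp)
      rw [div_lt_iff₀ (by positivity)]
      have : ((n : ℕ) : ℝ) < (((c + 1) * p : ℕ) : ℝ) := by exact_mod_cast h2
      push_cast at this; linarith
    · rw [le_div_iff₀ hc0]
      have : ((c * p : ℕ) : ℝ) ≤ ((n - k : ℕ) : ℝ) := by exact_mod_cast h1.le
      push_cast at this; linarith
  -- each cut gap contributes at most `θ((n−k)/c) − θ(max(n/(c+1), l))`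
  have hG : ∀ c ∈ Finset.Icc 1 h₀, ∑ p ∈ G c, Real.log p ≤
      Chebyshev.theta (((n - k : ℕ) : ℝ) / c) - Chebyshev.theta (max ((n : ℝ) / (c + 1)) (l : ℝ)) := by
    intro c hc
    obtain ⟨hc1, hch₀⟩ := Finset.mem_Icc.mp hc
    set x : ℝ := max ((n : ℝ) / (c + 1)) (l : ℝ) with hx
    set y : ℝ := ((n - k : ℕ) : ℝ) / c with hy
    have hx0 : 0 ≤ x := le_trans (by positivity) (le_max_left _ _)
    have hy0 : 0 ≤ y := by positivity
    have hc0 : (0 : ℝ) < c := by exact_mod_cast hc1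
    -- `x ≤ y` for `c ≤ h₀`
    have hh₀M : h₀ * M ≤ n - k := by rw [hh₀]; exact Nat.div_mul_le_self _ _
    have hknR : ((n - k : ℕ) : ℝ) = n - k := by rw [Nat.cast_sub (by omega)]
    have hxy : x ≤ y := by
      refine max_le ?_ ?_
      · -- `n/(c+1) ≤ (n−k)/c` iff `k (c+1) ≤ n`... from `c M ≤ h₀ M ≤ n − k`, `k ≤ M`
        have h1 : c * k ≤ n - k := by
          calc c * k ≤ c * M := Nat.mul_le_mul_left c (le_max_left k l)
            _ ≤ h₀ * M := Nat.mul_le_mul_right M hch₀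
            _ ≤ n - k := hh₀M
        have h1R : (c : ℝ) * k ≤ n - k := by rw [← hknR]; exact_mod_cast h1
        rw [hy, hknR, div_le_div_iff₀ (by positivity) hc0]
        nlinarith
      · have h1 : c * l ≤ n - k := by
          calc c * l ≤ c * M := Nat.mul_le_mul_left c (le_max_right k l)
            _ ≤ h₀ * M := Nat.mul_le_mul_right M hch₀
            _ ≤ n - k := hh₀M
        rw [hy, le_div_iff₀ hc0]
        have : l * c ≤ n - k := by rw [mul_comm]; exact h1
        exact_mod_cast this
    rw [Chebyshev.theta_eq_sum_primesLE y, Chebyshev.theta_eq_sum_primesLE x]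
    rw [← Finset.sum_filter_add_sum_filter_not (Nat.primesLE ⌊y⌋₊) (fun p => p ≤ ⌊x⌋₊)]
    have hGeq : G c = (Nat.primesLE ⌊y⌋₊).filter (fun p => ¬ p ≤ ⌊x⌋₊) := by
      ext p
      simp only [G, Finset.mem_filter, Nat.mem_primesLE, not_le]
      constructor
      · rintro ⟨⟨_, hpp⟩, h1, h2⟩
        exact ⟨⟨Nat.le_floor h2, hpp⟩, (Nat.floor_lt hx0).mpr h1⟩
      · rintro ⟨⟨hpy, hpp⟩, hpx⟩
        have hpy' : (p : ℝ) ≤ y := (Nat.le_floor_iff hy0).mp hpy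
        have hpx' : x < p := (Nat.floor_lt hx0).mp hpx
        refine ⟨⟨?_, hpp⟩, hpx', hpy'⟩
        have hnk' : ((n - k : ℕ) : ℝ) ≤ n := by exact_mod_cast Nat.sub_le n k
        have : y ≤ n := (div_le_self (by positivity) (by exact_mod_cast hc1)).trans hnk'
        exact_mod_cast hpy'.trans this
    have hxe : (Nat.primesLE ⌊y⌋₊).filter (fun p => p ≤ ⌊x⌋₊) = Nat.primesLE ⌊x⌋₊ := by
      ext p
      simp only [Finset.mem_filter, Nat.mem_primesLE]
      constructor
      · rintro ⟨⟨_, hpp⟩, hpx⟩; exact ⟨hpx, hpp⟩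
      · rintro ⟨hpx, hpp⟩; exact ⟨⟨hpx.trans (Nat.floor_le_floor hxy), hpp⟩, hpx⟩
    rw [hGeq, hxe]; linarith
  have h1 : ∑ p ∈ ((Nat.primesLE n) \ L.primeFactors).filter (fun p => l < p), Real.log p ≤
      ∑ p ∈ (Finset.Icc 1 h₀).biUnion G, Real.log p :=
    Finset.sum_le_sum_of_subset_of_nonneg hcover fun p _ _ => Real.log_natCast_nonneg p
  have h2 : ∑ p ∈ (Finset.Icc 1 h₀).biUnion G, Real.log p ≤
      ∑ c ∈ Finset.Icc 1 h₀, ∑ p ∈ G c, Real.log p :=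
    sum_biUnion_le_sum _ G _ fun p => Real.log_natCast_nonneg p
  have h3 := Finset.sum_le_sum hG
  rw [hθ, hsplit]
  linarith


/-- `Σ_{c=1}^{h} max(n/(c+1), l) ≥ n (H_{h+1} − 1) + (max(n/(h+1), l) − n/(h+1))` (for `l ≤ n`).
[folklore] -/
theorem sum_max_div_ge (n l h : ℕ) (hln : l ≤ n) :
    n * ((harmonic (h + 1) : ℝ) - 1) + (max ((n : ℝ) / (h + 1)) (l : ℝ) - n / (h + 1)) ≤
      ∑ c ∈ Finset.Icc 1 h, max ((n : ℝ) / (c + 1)) (l : ℝ) := by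
  induction h with
  | zero =>
      rw [Finset.Icc_eq_empty (by omega), Finset.sum_empty]
      have h1 : (harmonic (0 + 1) : ℝ) = 1 := by
        rw [zero_add, harmonic_succ, harmonic_zero]; simp
      have hl : (l : ℝ) ≤ n := by exact_mod_cast hln
      rw [h1, sub_self, mul_zero, zero_add]
      simp only [CharP.cast_eq_zero, zero_add, div_one]
      rw [max_eq_left hl]; simp
  | succ h ih =>
      rw [Finset.sum_Icc_succ_top (by omega)]
      have hH : (harmonic (h + 1 + 1) : ℝ) = harmonic (h + 1) + 1 / ((h : ℝ) + 1 + 1) := by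
        rw [harmonic_succ]; push_cast; ring
      rw [hH]
      push_cast
      have hprev : (n : ℝ) / (h + 1) ≤ max ((n : ℝ) / (h + 1)) (l : ℝ) := le_max_left _ _
      have : (n : ℝ) / (↑h + 1 + 1) = n * (1 / ((h : ℝ) + 1 + 1)) := by ring
      nlinarith [ih, hprev, this, le_max_left ((n : ℝ) / (↑h + 1 + 1)) (l : ℝ)]

/-- The bookkeeping inequality behind the error term of the lower bound. [folklore] -/
theorem lemma50_lower_errorBound {η n l h H Q T mx smx : ℝ} (hη0 : 0 < η) (hn0 : 0 < n)
    (hln : l ≤ n) (hhQ : h ≤ Q) (hH0 : 0 ≤ H) (hHQ : H ≤ Q)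
    (hsmxle : smx ≤ h * n) (k : ℝ) (hk0 : 0 ≤ k)
    (hmain : n * (H - 1) + mx ≤ smx) :
    H * k + (mx - l) - (T + η * (n * (2 + 2 * Q))) ≤
      (1 - η) * n - ((1 + η) * l + T) - ((1 + η) * ((n - k) * H) - (1 - η) * smx) := by
  have hid : (1 - η) * n - ((1 + η) * l + T) - ((1 + η) * ((n - k) * H) - (1 - η) * smx) =
      (n - l - (n - k) * H + smx) - T - η * (n + l + (n - k) * H + smx) := by ring
  rw [hid]
  have e1 : (n - k) * H ≤ n * Q := by nlinarith
  have e2 : η * (n + l + (n - k) * H + smx) ≤ η * (n * (2 + 2 * Q)) := by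
    refine mul_le_mul_of_nonneg_left ?_ hη0.le
    nlinarith
  nlinarith

set_option maxHeartbeats 400000 in
/-- **CDT Lemma 50 (1), lower half, main regime** (`1 ≤ k < n`, `l ≤ n`, `n ≤ (Q+1)·max(k,l)`):
for every `Q ≥ 1`, `ε > 0` and large `n`,
`k·H_{h₀} + (n/(h₀+1) − l)⁺ − ε n ≤ log L^{≥l}_{n,k}`, `h₀ = ⌊(n−k)/max(k,l)⌋`.
[cite: CalegariDimitrovTang2024, §5 Lemma 50 (1) (p. 44)] -/
theorem le_log_radGe_main (Q : ℕ) (hQ : 1 ≤ Q) {ε : ℝ} (hε : 0 < ε) :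
    ∃ N₀ : ℕ, ∀ n k l : ℕ, N₀ ≤ n → 1 ≤ k → k < n → l ≤ n → n ≤ (Q + 1) * max k l →
      (harmonic ((n - k) / max k l) : ℝ) * k +
          max ((n : ℝ) / (((n - k) / max k l : ℕ) + 1) - l) 0 - ε * n ≤
        Real.log (radGe n k l) := by
  obtain ⟨η, hη⟩ : ∃ η : ℝ, η = ε / (4 * (Q + 1)) := ⟨_, rfl⟩
  have hQ0 : (0 : ℝ) < Q := by exact_mod_cast hQ
  have hQ1 : (0 : ℝ) < Q + 1 := by positivity
  have hη0 : 0 < η := by rw [hη]; positivity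
  obtain ⟨X₁, hX₁⟩ := Filter.eventually_atTop.mp (eventually_mul_le_theta hη0)
  obtain ⟨X₂, hX₂⟩ := Filter.eventually_atTop.mp (eventually_theta_le_mul hη0)
  set X : ℝ := max (max X₁ X₂) 0 with hXdef
  have hX0 : 0 ≤ X := le_max_right _ _
  have hXX₁ : X₁ ≤ X := (le_max_left _ _).trans (le_max_left _ _)
  have hXX₂ : X₂ ≤ X := (le_max_right _ _).trans (le_max_left _ _)
  set T : ℝ := Chebyshev.theta X with hTdef
  have hT0 : 0 ≤ T := Chebyshev.theta_nonneg X
  refine ⟨max ⌈((Q : ℝ) + 1) * (X + 1)⌉₊ ⌈2 * T / ε⌉₊, ?_⟩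
  intro n k l hn hk hkn hln hreg
  obtain ⟨M, hM⟩ : ∃ M : ℕ, M = max k l := ⟨_, rfl⟩
  obtain ⟨h₀, hh₀⟩ : ∃ h₀ : ℕ, h₀ = (n - k) / max k l := ⟨_, rfl⟩
  have hsieve := sieve_le_log_radGe n k l hk (by omega) hln
  rw [← hh₀] at hsieve ⊢
  rw [← hM] at hreg hh₀
  have hM1 : 1 ≤ M := by rw [hM]; exact le_max_of_le_left hk
  have hM0 : (0 : ℝ) < M := by exact_mod_cast hM1
  have hn0 : (0 : ℝ) < n := by exact_mod_cast (show 0 < n by omega)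
  have hnk1 : 1 ≤ n - k := by omega
  have hnkR : ((n - k : ℕ) : ℝ) = n - k := by push_cast [Nat.cast_sub hkn.le]; ring
  have hn1 : ⌈((Q : ℝ) + 1) * (X + 1)⌉₊ ≤ n := le_of_max_le_left hn
  have hn2 : ⌈2 * T / ε⌉₊ ≤ n := le_of_max_le_right hn
  have hnR1 : ((Q : ℝ) + 1) * (X + 1) ≤ n := (Nat.le_ceil _).trans (by exact_mod_cast hn1)
  have hnR2 : 2 * T / ε ≤ n := (Nat.le_ceil _).trans (by exact_mod_cast hn2)
  have hregR : (n : ℝ) ≤ (Q + 1) * M := by exact_mod_cast hreg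
  have hh₀M : h₀ * M ≤ n - k := by rw [hh₀]; exact Nat.div_mul_le_self _ _
  have hh₀MR : (h₀ : ℝ) * M ≤ n - k := by rw [← hnkR]; exact_mod_cast hh₀M
  have hh₀Q : h₀ ≤ Q := by
    have h1 : h₀ * M < (Q + 1) * M := by
      calc h₀ * M ≤ n - k := hh₀M
        _ < n := by omega
        _ ≤ (Q + 1) * M := hreg
    have := Nat.lt_of_mul_lt_mul_right h1
    omega
  have hh₀QR : (h₀ : ℝ) ≤ Q := by exact_mod_cast hh₀Q
  have hbigX : X ≤ (n : ℝ) / (Q + 1) - 1 := by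
    rw [le_sub_iff_add_le, le_div_iff₀ hQ1]; linarith
  have hMn : (n : ℝ) / (Q + 1) ≤ M := by rw [div_le_iff₀ hQ1]; linarith
  have hX1 : ∀ t, X ≤ t → (1 - η) * t ≤ Chebyshev.theta t := fun t ht => hX₁ t (hXX₁.trans ht)
  have hX2 : ∀ t, X ≤ t → Chebyshev.theta t ≤ (1 + η) * t := fun t ht => hX₂ t (hXX₂.trans ht)
  have hnq : (n : ℝ) / (Q + 1) ≤ n := div_le_self hn0.le (by linarith)
  -- `θ(n) ≥ (1−η) n`
  have hA : (1 - η) * n ≤ Chebyshev.theta n := hX1 n (hbigX.trans (by linarith))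
  -- `θ(l) ≤ (1+η) l + T`
  have hB : Chebyshev.theta l ≤ (1 + η) * l + T := by
    have hl0 : (0 : ℝ) ≤ l := by positivity
    by_cases hlX : X ≤ l
    · have := hX2 l hlX; linarith
    · push Not at hlX
      have := Chebyshev.theta_mono hlX.le
      nlinarith
  -- the gap terms
  have hgap : ∀ c ∈ Finset.Icc 1 h₀,
      Chebyshev.theta (((n - k : ℕ) : ℝ) / c) - Chebyshev.theta (max ((n : ℝ) / (c + 1)) (l : ℝ)) ≤
      (1 + η) * (((n - k : ℕ) : ℝ) / c) - (1 - η) * max ((n : ℝ) / (c + 1)) (l : ℝ) := by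
    intro c hc
    obtain ⟨hc1, hch⟩ := Finset.mem_Icc.mp hc
    have hc0 : (0 : ℝ) < c := by exact_mod_cast hc1
    have hch' : (c : ℝ) ≤ h₀ := by exact_mod_cast hch
    have hh₀0 : (0 : ℝ) < h₀ := by exact_mod_cast (show 0 < h₀ by omega)
    have hy : (n : ℝ) / (Q + 1) - 1 ≤ ((n - k : ℕ) : ℝ) / c := by
      rw [hnkR]
      have h1 : (M : ℝ) ≤ (n - k) / h₀ := by rw [le_div_iff₀ hh₀0]; linarith
      have h2 : ((n : ℝ) - k) / h₀ ≤ (n - k) / c :=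
        div_le_div_of_nonneg_left (by linarith [show (k:ℝ) ≤ n from by exact_mod_cast hkn.le]) hc0 hch'
      linarith
    have hx : (n : ℝ) / (Q + 1) - 1 ≤ max ((n : ℝ) / (c + 1)) (l : ℝ) := by
      have hc1' : (0 : ℝ) < c + 1 := by positivity
      have h1 : (n : ℝ) / (Q + 1) ≤ (n : ℝ) / (c + 1) :=
        div_le_div_of_nonneg_left hn0.le hc1' (by linarith)
      linarith [le_max_left ((n : ℝ) / (c + 1)) (l : ℝ)]
    have := hX2 _ (hbigX.trans hy)
    have := hX1 _ (hbigX.trans hx)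
    linarith
  have hsum := Finset.sum_le_sum hgap
  -- evaluate
  obtain ⟨H, hHdef⟩ : ∃ H : ℝ, H = (harmonic h₀ : ℝ) := ⟨_, rfl⟩
  have hS1 : ∑ c ∈ Finset.Icc 1 h₀, (1 / (c : ℝ)) = H := by rw [hHdef]; exact sum_Icc_inv_eq_harmonic h₀
  have hsumY : ∑ c ∈ Finset.Icc 1 h₀, (((n - k : ℕ) : ℝ) / c) = (n - k) * H := by
    rw [← hS1, Finset.mul_sum]
    exact Finset.sum_congr rfl fun c _ => by rw [hnkR]; ring
  set smx : ℝ := ∑ c ∈ Finset.Icc 1 h₀, max ((n : ℝ) / (c + 1)) (l : ℝ) with hsmx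
  have hsmxge := sum_max_div_ge n l h₀ hln
  have hHsucc : (harmonic (h₀ + 1) : ℝ) = H + 1 / ((h₀ : ℝ) + 1) := by
    rw [hHdef, harmonic_succ]; push_cast; ring
  rw [hHsucc] at hsmxge
  set mx : ℝ := max ((n : ℝ) / (h₀ + 1)) (l : ℝ) with hmx
  have hmain' : (n : ℝ) * (H - 1) + mx ≤ smx := by
    have : (n : ℝ) * (H + 1 / ((h₀ : ℝ) + 1) - 1) + (mx - n / (h₀ + 1)) = n * (H - 1) + mx := by ring
    linarith
  have hH0 : 0 ≤ H := by rw [← hS1]; exact Finset.sum_nonneg fun c _ => by positivity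
  have hHQ : H ≤ Q := by
    rw [← hS1]
    calc ∑ c ∈ Finset.Icc 1 h₀, (1 / (c : ℝ)) ≤ ∑ c ∈ Finset.Icc 1 h₀, (1 : ℝ) := by
          refine Finset.sum_le_sum fun c hc => ?_
          have : (1 : ℝ) ≤ c := by exact_mod_cast (Finset.mem_Icc.mp hc).1
          exact (div_le_one (by linarith)).mpr this
      _ = h₀ := by simp
      _ ≤ Q := hh₀QR
  have hsmx0 : 0 ≤ smx := Finset.sum_nonneg fun c _ => le_trans (by positivity) (le_max_left _ _)
  have hsmxle : smx ≤ h₀ * n := by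
    calc smx ≤ ∑ c ∈ Finset.Icc 1 h₀, (n : ℝ) := by
          refine Finset.sum_le_sum fun c hc => max_le ?_ (by exact_mod_cast hln)
          exact div_le_self hn0.le (by linarith [show (0:ℝ) ≤ c from by positivity])
      _ = h₀ * n := by simp
  have hkn' : (k : ℝ) ≤ n := by exact_mod_cast hkn.le
  have hk0 : (0 : ℝ) ≤ k := by positivity
  have hl0 : (0 : ℝ) ≤ l := by positivity
  have hlnR : (l : ℝ) ≤ n := by exact_mod_cast hln
  have hh₀0' : (0 : ℝ) ≤ h₀ := by positivity
  have herr := lemma50_lower_errorBound (mx := mx) (T := T) hη0 hn0 hlnR hh₀QR hH0 hHQ hsmxle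
    (k : ℝ) hk0 hmain'
  -- `T + η n (2 + 2Q) ≤ ε n`
  have hε1 : η * (n * (2 + 2 * Q)) = ε / 2 * n := by rw [hη]; field_simp; ring
  have hε2 : T ≤ ε / 2 * n := by
    have := hnR2; rw [div_le_iff₀ hε] at this; linarith
  have hpos : mx - l = max ((n : ℝ) / (h₀ + 1) - l) 0 := by
    rw [hmx]
    rcases le_total ((n : ℝ) / (h₀ + 1)) l with hle | hle
    · rw [max_eq_right hle, max_eq_right (by linarith)]; ring
    · rw [max_eq_left hle, max_eq_left (by linarith)]
  -- combine: the sieve sum in `hsieve` dominates the PNT expression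
  have hstep : (1 - η) * n - ((1 + η) * l + T) -
      ((1 + η) * ((n - k) * H) - (1 - η) * smx) ≤ Real.log (radGe n k l) := by
    have h1 : ∑ c ∈ Finset.Icc 1 h₀, ((1 + η) * (((n - k : ℕ) : ℝ) / c) -
        (1 - η) * max ((n : ℝ) / (c + 1)) (l : ℝ)) = (1 + η) * ((n - k) * H) - (1 - η) * smx := by
      rw [Finset.sum_sub_distrib, ← Finset.mul_sum, ← Finset.mul_sum, hsumY]
    linarith [hsieve, hsum, hA, hB, h1]
  have hcast : ((((n - k) / M : ℕ) : ℕ) : ℝ) + 1 = (h₀ : ℝ) + 1 := by rw [hh₀]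
  calc (harmonic h₀ : ℝ) * k + max ((n : ℝ) / ((h₀ : ℕ) + 1) - l) 0 - ε * n
      = H * k + (mx - l) - ε * n := by rw [hHdef, hpos]
    _ ≤ H * k + (mx - l) - (T + η * (n * (2 + 2 * Q))) := by linarith
    _ ≤ _ := herr
    _ ≤ Real.log (radGe n k l) := hstep


/-- The main term of Lemma 50 is small for small `max(k,l)`: if `1 ≤ k ≤ n`, `l ≤ n`, `Q ≥ 1` and
`(Q+1)·max(k,l) < n` then `k·H_{h₀} + (n/(h₀+1) − l)⁺ ≤ 5n/√(Q+1)`, `h₀ = ⌊(n−k)/max(k,l)⌋`.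
[folklore] -/
theorem mainTerm50_le_of_small {n k l Q : ℕ} (hk : 1 ≤ k) (hkn : k ≤ n) (hQ : 1 ≤ Q)
    (hsmall : (Q + 1) * max k l < n) :
    (harmonic ((n - k) / max k l) : ℝ) * k +
        max ((n : ℝ) / (((n - k) / max k l : ℕ) + 1) - l) 0 ≤ 5 * n / Real.sqrt (Q + 1) := by
  obtain ⟨M, hM⟩ : ∃ M : ℕ, M = max k l := ⟨_, rfl⟩
  obtain ⟨h₀, hh₀⟩ : ∃ h₀ : ℕ, h₀ = (n - k) / max k l := ⟨_, rfl⟩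
  rw [← hh₀]
  rw [← hM] at hsmall hh₀
  have hkM : k ≤ M := by rw [hM]; exact le_max_left k l
  have hM1 : 1 ≤ M := le_trans hk hkM
  have hM0 : (0 : ℝ) < M := by exact_mod_cast hM1
  have hk0 : (0 : ℝ) < k := by exact_mod_cast hk
  have hn0 : (0 : ℝ) < n := by exact_mod_cast (show 0 < n by omega)
  have hQ1 : (0 : ℝ) < (Q : ℝ) + 1 := by positivity
  have hQ2 : (2 : ℝ) ≤ (Q : ℝ) + 1 := by
    have : (1 : ℝ) ≤ Q := by exact_mod_cast hQ
    linarith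
  have hsmallR : ((Q : ℝ) + 1) * M < n := by exact_mod_cast hsmall
  have hkMR : (k : ℝ) ≤ M := by exact_mod_cast hkM
  have hknR : (k : ℝ) ≤ n := by exact_mod_cast hkn
  -- `k ≤ M < n/(Q+1) ≤ n/2`, so `n − k ≥ n/2`
  have hMn : (M : ℝ) < n / (Q + 1) := by rw [lt_div_iff₀ hQ1]; linarith
  have hMn2 : 2 * (M : ℝ) < n := by nlinarith
  have hnk2 : (n : ℝ) / 2 ≤ n - k := by linarith
  -- `h₀ M ≤ n − k < (h₀ + 1) M`
  have hnkN : ((n - k : ℕ) : ℝ) = n - k := by rw [Nat.cast_sub hkn]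
  have hh₀M : h₀ * M ≤ n - k := by rw [hh₀]; exact Nat.div_mul_le_self _ _
  have hh₀M' : n - k < (h₀ + 1) * M := by
    rw [hh₀]
    have := Nat.lt_div_mul_add (show 0 < M by omega) (a := n - k)
    linarith [mul_comm ((n - k) / M) M, add_mul ((n-k)/M) 1 M]
  have hh₀MR : (h₀ : ℝ) * M ≤ n - k := by rw [← hnkN]; exact_mod_cast hh₀M
  have hh₀MR' : (n : ℝ) - k < (h₀ + 1) * M := by
    rw [← hnkN]; exact_mod_cast hh₀M'
  have hh₀1R : (0 : ℝ) < (h₀ : ℝ) + 1 := by positivity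
  -- (i) `(n/(h₀+1) − l)⁺ ≤ n/(h₀+1) ≤ 2M ≤ 2n/(Q+1)`
  have hi : max ((n : ℝ) / ((h₀ : ℕ) + 1) - l) 0 ≤ 2 * n / (Q + 1) := by
    refine max_le ?_ (by positivity)
    have hl0 : (0 : ℝ) ≤ l := by positivity
    have h1 : (n : ℝ) / (h₀ + 1) ≤ 2 * M := by
      rw [div_le_iff₀ hh₀1R]
      -- `n ≤ 2 (n − k) < 2 (h₀+1) M`
      nlinarith
    have h2 : 2 * (M : ℝ) ≤ 2 * n / (Q + 1) := by
      rw [le_div_iff₀ hQ1]; nlinarith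
    linarith
  -- (ii) `k H_{h₀} ≤ k (1 + 2√h₀) ≤ k + 2 √(k (n − k)) ≤ n/(Q+1) + 2 n/√(Q+1)`
  have hH : (harmonic h₀ : ℝ) ≤ 1 + 2 * Real.sqrt h₀ := by
    have h1 : (harmonic h₀ : ℝ) ≤ 1 + Real.log h₀ := harmonic_le_one_add_log _
    have h3 : Real.log h₀ ≤ 2 * Real.sqrt h₀ := by
      have := Real.log_le_rpow_div (show (0 : ℝ) ≤ h₀ by positivity) (show (0 : ℝ) < 1 / 2 by norm_num)
      rw [← Real.sqrt_eq_rpow] at this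
      linarith
    linarith
  have hkh : (k : ℝ) * h₀ ≤ n := by
    have : (k : ℝ) * h₀ ≤ M * h₀ := mul_le_mul_of_nonneg_right hkMR (by positivity)
    nlinarith
  have hsq1 : Real.sqrt h₀ * k ≤ Real.sqrt n * Real.sqrt k := by
    have h1 : Real.sqrt h₀ * Real.sqrt k = Real.sqrt (h₀ * k) := (Real.sqrt_mul (by positivity) _).symm
    have h2 : Real.sqrt (h₀ * k) ≤ Real.sqrt n := Real.sqrt_le_sqrt (by nlinarith)
    calc Real.sqrt h₀ * k = Real.sqrt h₀ * Real.sqrt k * Real.sqrt k := by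
          rw [mul_assoc, Real.mul_self_sqrt hk0.le]
      _ = Real.sqrt (h₀ * k) * Real.sqrt k := by rw [h1]
      _ ≤ Real.sqrt n * Real.sqrt k := mul_le_mul_of_nonneg_right h2 (Real.sqrt_nonneg _)
  have hkQ : (k : ℝ) ≤ n / (Q + 1) := by linarith [hMn.le]
  have hsq2 : Real.sqrt n * Real.sqrt k ≤ n / Real.sqrt (Q + 1) := by
    have h1 : Real.sqrt k ≤ Real.sqrt (n / (Q + 1)) := Real.sqrt_le_sqrt hkQ
    have h2 : Real.sqrt (n / (Q + 1)) = Real.sqrt n / Real.sqrt (Q + 1) := Real.sqrt_div' _ hQ1.le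
    have h3 : Real.sqrt n * Real.sqrt n = n := Real.mul_self_sqrt hn0.le
    calc Real.sqrt n * Real.sqrt k ≤ Real.sqrt n * (Real.sqrt n / Real.sqrt (Q + 1)) := by
          rw [← h2]; exact mul_le_mul_of_nonneg_left h1 (Real.sqrt_nonneg _)
      _ = n / Real.sqrt (Q + 1) := by rw [mul_div_assoc', h3]
  have hsQ : 0 < Real.sqrt (Q + 1) := Real.sqrt_pos.mpr hQ1
  have hsqle : Real.sqrt ((Q : ℝ) + 1) ≤ Q + 1 := by
    have := Real.sqrt_le_sqrt (show (Q : ℝ) + 1 ≤ (Q + 1) ^ 2 by nlinarith)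
    rwa [Real.sqrt_sq hQ1.le] at this
  have hdiv : (n : ℝ) / (Q + 1) ≤ n / Real.sqrt (Q + 1) :=
    div_le_div_of_nonneg_left hn0.le hsQ hsqle
  have hii : (harmonic h₀ : ℝ) * k ≤ n / (Q + 1) + 2 * (n / Real.sqrt (Q + 1)) := by
    calc (harmonic h₀ : ℝ) * k ≤ (1 + 2 * Real.sqrt h₀) * k :=
          mul_le_mul_of_nonneg_right hH hk0.le
      _ = k + 2 * (Real.sqrt h₀ * k) := by ring
      _ ≤ n / (Q + 1) + 2 * (n / Real.sqrt (Q + 1)) := by linarith [hsq1.trans hsq2]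
  calc (harmonic h₀ : ℝ) * k + max ((n : ℝ) / ((h₀ : ℕ) + 1) - l) 0
      ≤ (n / (Q + 1) + 2 * (n / Real.sqrt (Q + 1))) + 2 * n / (Q + 1) := add_le_add hii hi
    _ ≤ 3 * (n / Real.sqrt (Q + 1)) + 2 * (n / Real.sqrt (Q + 1)) := by
        have : 2 * (n : ℝ) / (Q + 1) = 2 * (n / (Q + 1)) := by ring
        rw [this]; linarith
    _ = 5 * n / Real.sqrt (Q + 1) := by ring

set_option maxHeartbeats 400000 in
/-- **CDT Lemma 50 (1), lower half, uniformly in `1 ≤ k < n`, `0 ≤ l ≤ n`**: for every `ε > 0`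
there is `N₀` with `k·H_{h₀} + (n/(h₀+1) − l)⁺ − ε n ≤ log L^{≥l}_{n,k}` for all `n ≥ N₀`.
Together with `log_radGe_le_uniform` this is the uniform asymptotic
`log L^{≥l}_{n,k} = k Σ_{h≤⌊(n−k)/max(k,l)⌋} 1/h + (n/⌊(n+(l−k)⁺)/max(k,l)⌋ − l)⁺ + o(n)` of
Lemma 50 (1). [cite: CalegariDimitrovTang2024, §5 Lemma 50 (1) (p. 44)] -/
theorem le_log_radGe_uniform {ε : ℝ} (hε : 0 < ε) :
    ∃ N₀ : ℕ, ∀ n k l : ℕ, N₀ ≤ n → 1 ≤ k → k < n → l ≤ n →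
      (harmonic ((n - k) / max k l) : ℝ) * k +
          max ((n : ℝ) / (((n - k) / max k l : ℕ) + 1) - l) 0 - ε * n ≤
        Real.log (radGe n k l) := by
  -- `Q` with `5/√(Q+1) ≤ ε`
  set Q : ℕ := ⌈25 / ε ^ 2⌉₊ + 1 with hQdef
  have hQ1 : 1 ≤ Q := by omega
  have hQR : 25 / ε ^ 2 ≤ (Q : ℝ) := (Nat.le_ceil _).trans (by rw [hQdef]; push_cast; linarith)
  obtain ⟨N₁, hN₁⟩ := le_log_radGe_main Q hQ1 hε
  refine ⟨max N₁ 1, ?_⟩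
  intro n k l hn hk hkn hln
  have hn1 : N₁ ≤ n := le_of_max_le_left hn
  have hn0 : (0 : ℝ) < n := by exact_mod_cast (show 0 < n by omega)
  have hlog0 : 0 ≤ Real.log (radGe n k l) := log_radGe_nonneg n k l
  by_cases hreg : n ≤ (Q + 1) * max k l
  · exact hN₁ n k l hn1 hk hkn hln hreg
  · push Not at hreg
    have hmain := mainTerm50_le_of_small hk hkn.le hQ1 hreg
    have hQ1R : (0 : ℝ) < (Q : ℝ) + 1 := by positivity
    have hsQ : 0 < Real.sqrt (Q + 1) := Real.sqrt_pos.mpr hQ1R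
    have h16 : 25 / ε ^ 2 ≤ (Q : ℝ) + 1 := by linarith
    have hsq : 5 / ε ≤ Real.sqrt (Q + 1) := by
      have h1 : Real.sqrt (25 / ε ^ 2) = 5 / ε := by
        rw [show (25 : ℝ) / ε ^ 2 = (5 / ε) ^ 2 by ring, Real.sqrt_sq (by positivity)]
      rw [← h1]; exact Real.sqrt_le_sqrt h16
    have hbd : 5 * (n : ℝ) / Real.sqrt (Q + 1) ≤ ε * n := by
      rw [div_le_iff₀ hsQ]
      have h2 : 5 ≤ ε * Real.sqrt (Q + 1) := by
        have := mul_le_mul_of_nonneg_left hsq hε.le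
        rwa [mul_div_cancel₀ _ hε.ne'] at this
      nlinarith
    linarith


end CalegariDimitrovTang

end Literature.NumberTheory.Transcendental
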